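import Summits.ResolutionOfSingularities.ResolutionOfSingularities.Theorems.HomologicalConductorNoZenoExcOrderStalks
import Summits.ResolutionOfSingularities.ResolutionOfSingularities.Theorems.HomologicalConductorNoZenoCarriedPrincipalClosed
import Summits.ResolutionOfSingularities.ResolutionOfSingularities.Theorems.HomologicalConductorNoZenoExcDegreeNonzero
import Summits.ResolutionOfSingularities.ResolutionOfSingularities.Theorems.HomologicalConductorNoZenoSplitExcCount
import Literature.AlgebraicGeometry.Resolution.AlterationsBoundaryDivisor
import Literature.AlgebraicGeometry.Motives.CartierDivisorOfIdealSheaf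
import Mathlib.AlgebraicGeometry.Morphisms.SchemeTheoreticallyDominant
import HarnessLib

/-!
# Crux `NoZenoR` (stmt-ResolutionOfSingularities-19943), slot `stub_L1wCoreF3`, (B1) split core: the base ideal
# `𝔞·𝒪_X` of an `𝔪`-primary ideal principalised on the closed fibre is an EFFECTIVE CARTIER DIVISOR supported on
# the closed fibre

Route `ResolutionOfSingularities/HomologicalConductor`.  OURS (cell res-hironaka, crux chain W4.4, lead seat
res-L0-w44-lead-1 g8, memo `B1-CENSUS-g8.md`); nothing here is a statement of the manuscript under review (Hironaka
2017); AI-written, weaker than expert review.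

The sandwich hypothesis `ExcCount.IsSepX1Sandwiched S I` of the registered stub hands the (B1) split core a scheme
`X¹ → Spec S` on which `I·𝒪_(X¹,x)` is principal at every point `x` whose structure map `S → 𝒪_(X¹,x)` is local.  This
file turns that clause into the two objects STEP 3 consumes: the ideal sheaf `𝔞𝒪_X := ofIdealTop (𝔞·Γ(X, 𝒪_X))`
(stub-2's dictionary, `…NoZenoExcOrderStalks`) is an EFFECTIVE CARTIER DIVISOR (input of `Blowups.IsBlowup.lift`, i.e.
of UP-2 `SurfaceTermination.ChartResolution.exists_isResolution_chartMorphism`), and its Cartier divisor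
`Z := CartierDivisor.ofIsEffectiveCartier (𝔞𝒪_X)` is effective, supported EXACTLY on the closed fibre (input of UP-1′
`…NoZenoExcDegreeNonzero` / `…NoZenoExcDegreeAvoids`).  For `π : X → Spec T` (`T` local, `X` integral):

* `isLocalHom_toStalk_of_base_eq` — over the closed point the structure map `T → 𝒪_(X,x)` is local (so the sandwich
  clause applies there); `stalkIdeal_baseIdeal_eq_map_toStalk` — `(𝔞𝒪_X)_x = 𝔞·𝒪_(X,x)` in `ExcCount.toStalk` spelling;
* `not_mem_support_baseIdeal_of_base_ne` / `mem_support_baseIdeal_of_base_eq` / `support_baseIdeal_eq` — for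
  `𝔪ᶜ ≤ 𝔞 ≤ 𝔪`, **`Supp (𝔞𝒪_X) = π⁻¹(𝔪)`**;
* `toStalk_injective` — `T → 𝒪_(X,x)` is injective for `π` dominant;
* `isEffectiveCartier_baseIdeal` — **`𝔞𝒪_X` is an effective Cartier divisor** when `𝔞 ≠ 0`, `𝔪ᶜ ≤ 𝔞`, and
  `𝔞·𝒪_(X,x)` is principal wherever `T → 𝒪_(X,x)` is local (tree `isEffectiveCartier_of_stalkIdeal_eq_span_singleton`);
* `baseIdealDivisor_isEffective`, `baseIdealDivisor_avoids_iff`, `exists_not_avoids_baseIdealDivisor` — the divisor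
  `Z` is effective, avoids `x` iff `π x ≠ 𝔪`, and does not avoid some point (`π` surjective).

References: U. Görtz, T. Wedhorn, *Algebraic Geometry I* (2020), Remark 11.27 / (13.19) [`GortzWedhorn2020`]; The Stacks
Project, Tag 01WS [`StacksProject`]; res-L0-w44-stub-2 (L1)-PREP v2 §2 (OURS).
-/

noncomputable section

-- single-problem summit: the doubled namespace component `ResolutionOfSingularities` is forced
set_option linter.dupNamespace false

namespace Summit.ResolutionOfSingularities.ResolutionOfSingularities.Theorems.NoZeno.ExcCount

open CategoryTheory AlgebraicGeometry TopologicalSpace IsLocalRing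
open Literature.AlgebraicGeometry Literature.AlgebraicGeometry.Resolution Literature.AlgebraicGeometry.Motives
open Summit.ResolutionOfSingularities.ResolutionOfSingularities.Theorems.NoZeno.SandwichCluster
  (not_isUnit_germ_appTop_of_mem_maximalIdeal)
open Summit.ResolutionOfSingularities.ResolutionOfSingularities.Theorems.NoZeno.SandwichCluster.LemmaL
  (stalkIdeal_ofIdealTop_map stalkIdeal_ofIdealTop_map_eq_top_of_base_ne)


section Base

variable {T : Type} [CommRing T] [IsLocalRing T] {X : Scheme.{0}} (π : X ⟶ Spec (.of T))

omit [IsLocalRing T] in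
/-- `ExcCount.toStalk π x` is the composite `T → Γ(X, 𝒪_X) → 𝒪_(X,x)` (`rfl`). [folklore] -/
theorem toStalk_eq_germ_comp_algebraMapΓ (x : X) :
    toStalk π x = (X.presheaf.germ ⊤ x trivial).hom.comp (Morphisms.algebraMapΓ π) := rfl

/-- **Over the closed point the structure map `T → 𝒪_(X,x)` is local.** [folklore] -/
theorem isLocalHom_toStalk_of_base_eq {x : X} (hx : π.base x = closedPoint T) : IsLocalHom (toStalk π x) := by
  refine ⟨fun t ht => ?_⟩
  by_contra hnu
  have hmem : t ∈ maximalIdeal T := (IsLocalRing.mem_maximalIdeal t).mpr hnu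
  exact not_isUnit_germ_appTop_of_mem_maximalIdeal π hx hmem ht

omit [IsLocalRing T] in
/-- The stalk of the base ideal sheaf `𝔞𝒪_X` at `x` is `𝔞·𝒪_(X,x)` (stub-2's `stalkIdeal_ofIdealTop_map` in the
`toStalk` spelling). [folklore] -/
theorem stalkIdeal_baseIdeal_eq_map_toStalk (𝔞 : Ideal T) (x : X) :
    stalkIdeal (Scheme.IdealSheafData.ofIdealTop (𝔞.map (Morphisms.algebraMapΓ π))) x = 𝔞.map (toStalk π x) :=
  stalkIdeal_ofIdealTop_map π 𝔞 x

/-- Off the closed fibre a point is NOT in the support of `𝔞𝒪_X`, as soon as `𝔪ᶜ ≤ 𝔞`. [folklore] -/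
theorem not_mem_support_baseIdeal_of_base_ne {𝔞 : Ideal T} {c : ℕ} (hc : maximalIdeal T ^ c ≤ 𝔞) {x : X}
    (hx : π.base x ≠ closedPoint T) :
    x ∉ (Scheme.IdealSheafData.ofIdealTop (𝔞.map (Morphisms.algebraMapΓ π))).support := by
  intro hmem
  have hle := (mem_support_iff_stalkIdeal_le _ x).mp hmem
  rw [stalkIdeal_ofIdealTop_map_eq_top_of_base_ne π hc hx] at hle
  exact (maximalIdeal.isMaximal _).ne_top (top_le_iff.mp hle)

/-- Over the closed fibre every point IS in the support of `𝔞𝒪_X`, as soon as `𝔞 ≤ 𝔪`. [folklore] -/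
theorem mem_support_baseIdeal_of_base_eq {𝔞 : Ideal T} (h𝔞 : 𝔞 ≤ maximalIdeal T) {x : X}
    (hx : π.base x = closedPoint T) :
    x ∈ (Scheme.IdealSheafData.ofIdealTop (𝔞.map (Morphisms.algebraMapΓ π))).support := by
  rw [mem_support_iff_stalkIdeal_le, stalkIdeal_baseIdeal_eq_map_toStalk]
  haveI := isLocalHom_toStalk_of_base_eq π hx
  refine (Ideal.map_le_iff_le_comap).mpr fun t ht => ?_
  rw [Ideal.mem_comap, IsLocalRing.mem_maximalIdeal, mem_nonunits_iff]
  intro hu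
  exact (IsLocalRing.mem_maximalIdeal t).mp (h𝔞 ht) ((isUnit_map_iff (toStalk π x) t).mp hu)

/-- **`Supp (𝔞𝒪_X) = π⁻¹(𝔪)`** for `𝔪ᶜ ≤ 𝔞 ≤ 𝔪`. [folklore] -/
theorem support_baseIdeal_eq {𝔞 : Ideal T} {c : ℕ} (hc : maximalIdeal T ^ c ≤ 𝔞) (h𝔞 : 𝔞 ≤ maximalIdeal T) :
    ((Scheme.IdealSheafData.ofIdealTop (𝔞.map (Morphisms.algebraMapΓ π))).support : Set X) =
      π.base ⁻¹' {closedPoint T} := by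
  ext x
  constructor
  · intro hx
    by_contra hne
    exact not_mem_support_baseIdeal_of_base_ne π hc hne hx
  · intro hx
    exact mem_support_baseIdeal_of_base_eq π h𝔞 hx

omit [IsLocalRing T] in
/-- For `π` quasi-compact dominant from an integral `X` into `Spec` of a domain, `T → 𝒪_(X,x)` is injective. [folklore] -/
theorem toStalk_injective [IsIntegral X] [IsDomain T] [IsDominant π] [QuasiCompact π] (x : X) :
    Function.Injective (toStalk π x) := by
  haveI : IsSchemeTheoreticallyDominant π := .of_isDominant π
  rw [toStalk_eq_germ_comp_algebraMapΓ, RingHom.coe_comp]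
  refine (germ_injective_of_isIntegral (X := X) (U := ⊤) x trivial).comp ?_
  change Function.Injective (π.appTop.hom.comp (Scheme.ΓSpecIso (.of T)).inv.hom)
  rw [RingHom.coe_comp]
  exact (π.app_injective ⊤).comp (Scheme.ΓSpecIso (.of T)).commRingCatIsoToRingEquiv.symm.injective

/-- **`𝔞𝒪_X` is an effective Cartier divisor** when `𝔞 ≠ 0`, `𝔪ᶜ ≤ 𝔞`, and `𝔞·𝒪_(X,x)` is principal at every point
whose structure map is local (the clause of `ExcCount.IsSepX1Sandwiched`): at a point of the support (necessarily over
the closed point) the stalk `𝔞·𝒪_(X,x)` is principal and non-zero. [cite: StacksProject, Tag 01WS] -/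
theorem isEffectiveCartier_baseIdeal [IsIntegral X] [IsLocallyNoetherian X] [IsDomain T] [IsDominant π]
    [QuasiCompact π]
    {𝔞 : Ideal T} (h𝔞0 : 𝔞 ≠ ⊥) {c : ℕ} (hc : maximalIdeal T ^ c ≤ 𝔞)
    (hprin : ∀ x : X, IsLocalHom (toStalk π x) → (𝔞.map (toStalk π x)).IsPrincipal) :
    IsEffectiveCartier (Scheme.IdealSheafData.ofIdealTop (𝔞.map (Morphisms.algebraMapΓ π))) := by
  refine isEffectiveCartier_of_stalkIdeal_eq_span_singleton fun x hx => ?_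
  have hx0 : π.base x = closedPoint T := by
    by_contra hne
    exact not_mem_support_baseIdeal_of_base_ne π hc hne hx
  obtain ⟨g, hg⟩ := (hprin x (isLocalHom_toStalk_of_base_eq π hx0)).principal
  refine ⟨g, ?_, ?_⟩
  · intro hg0
    -- then `𝔞` maps to `0`, contradicting injectivity of `T → 𝒪_(X,x)` and `𝔞 ≠ 0`
    obtain ⟨a, ha, ha0⟩ := Submodule.exists_mem_ne_zero_of_ne_bot h𝔞0
    have h1 : toStalk π x a ∈ 𝔞.map (toStalk π x) := Ideal.mem_map_of_mem _ ha
    rw [hg, hg0] at h1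
    have : toStalk π x a = 0 := by simpa using h1
    exact ha0 (toStalk_injective π x (by rw [this, map_zero]))
  · rw [stalkIdeal_baseIdeal_eq_map_toStalk, hg]

end Base

/-! ## The exceptional cycle `Z` of `𝔞` as a Cartier divisor -/

section Divisor

variable {T : Type} [CommRing T] [IsLocalRing T] {X : Scheme.{0}} [IsIntegral X] (π : X ⟶ Spec (.of T))
  {𝔞 : Ideal T} (h : IsEffectiveCartier (Scheme.IdealSheafData.ofIdealTop (𝔞.map (Morphisms.algebraMapΓ π))))

omit [IsLocalRing T] in
/-- The Cartier divisor `Z` of `𝔞𝒪_X` is effective. [cite: GortzWedhorn2020, Remark 11.27 and (11.12) (pp. 378–379)] -/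
theorem baseIdealDivisor_isEffective :
    (CartierDivisor.ofIsEffectiveCartier _ h).IsEffective :=
  CartierDivisor.isEffective_ofIsEffectiveCartier _ h

/-- **`Z` avoids `x` iff `x` lies off the closed fibre** (`𝔪ᶜ ≤ 𝔞 ≤ 𝔪`). [folklore] -/
theorem baseIdealDivisor_avoids_iff {c : ℕ} (hc : maximalIdeal T ^ c ≤ 𝔞) (h𝔞 : 𝔞 ≤ maximalIdeal T) (x : X) :
    (CartierDivisor.ofIsEffectiveCartier _ h).Avoids x ↔ π.base x ≠ closedPoint T := by
  rw [CartierDivisor.avoids_ofIsEffectiveCartier_iff]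
  have hs := support_baseIdeal_eq π hc h𝔞
  constructor
  · intro hx heq
    exact hx (by rw [← SetLike.mem_coe, hs]; exact heq)
  · intro hne hx
    rw [← SetLike.mem_coe, hs] at hx
    exact hne hx

/-- `Z` avoids every point off the closed fibre. [folklore] -/
theorem baseIdealDivisor_avoids_of_base_ne {c : ℕ} (hc : maximalIdeal T ^ c ≤ 𝔞) (h𝔞 : 𝔞 ≤ maximalIdeal T)
    {x : X} (hx : π.base x ≠ closedPoint T) : (CartierDivisor.ofIsEffectiveCartier _ h).Avoids x :=
  (baseIdealDivisor_avoids_iff π h hc h𝔞 x).mpr hx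

/-- **`Z ≠ 0`: some point is not avoided** (any point over the closed point; `π` proper and dominant is surjective).
[folklore] -/
theorem exists_not_avoids_baseIdealDivisor [IsProper π] [IsDominant π] {c : ℕ} (hc : maximalIdeal T ^ c ≤ 𝔞)
    (h𝔞 : 𝔞 ≤ maximalIdeal T) : ∃ x₀ : X, ¬ (CartierDivisor.ofIsEffectiveCartier _ h).Avoids x₀ := by
  obtain ⟨x₀, hx₀⟩ := surjective_base_of_isProper π (closedPoint T)
  exact ⟨x₀, fun hav => ((baseIdealDivisor_avoids_iff π h hc h𝔞 x₀).mp hav) hx₀⟩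

end Divisor

end Summit.ResolutionOfSingularities.ResolutionOfSingularities.Theorems.NoZeno.ExcCount

end
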